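import Summits.AtomisticToContinuum.Crystallization.Theorems.FrustratedLawDichotomyKissingRigidityShape

/-!
# FrustratedLawDichotomy · crux `AperiodicFrustratedLawGap` (stmt-AtomisticToContinuum-27623) — KR_shape UNPACKED TO TWELVE POINTS: the census
# statement I-RIG′ in bond-graph-free form (decomp-a2c, prover hand 2, structural share, generation 7; route-independent up to its imports)

`KR_shape` (`FrustratedLawDichotomyKissingRigidityShape`, hypothesis of `kr_of_krShape`) speaks about the scale-free bond graph of an arbitrary
finite configuration.  What a charge-free(1/100) site `i` (twelve `1/100`-bonds, every bond of ring number `4`) actually hands to geometry is a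
TWELVE-POINT problem at scale `d = nn_i`:

* `KR_shape12` : for a centre `p`, a scale `d > 0`, twelve points `q : Fin 12 → ℝ³` with `d ≤ dist (q a) p ≤ 101/100·d`, pairwise
  `dist ≥ 100/101·d`, and a symmetric irreflexive «contact» relation `E` with `dist ≤ 10201/10000·d` on contacts, `dist > d` on non-contacts and
  EXACTLY FOUR contacts at every point — the dozen is within `η·d` (`η < 1/20`) of `d·A(fcc or hcp kissing pattern)` for a linear isometry `A`
  and a bijection pattern `≃ Fin 12`.  (The cuboctahedron and the anticuboctahedron are the two `4`-regular `24`-contact kissing dozens; the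
  statement asks for their `2 %`-robustness — finite-dimensional, census line I-RIG′.)

* `krShape_of_krShape12` : `KR_shape12 → KR_shape` — unpacking of `Literature…IsChargeFree` / `bondGraph` / `ringNumber` / `nearestDist`:
  bonded neighbours `j` of `i` have `d ≤ dist ≤ 101/100·min(d, nn_j)`, hence `nn_j ∈ [100/101·d, 101/100·d]`; two bonded neighbours are
  `≥ nn_j ≥ 100/101·d` apart, `≤ 101/100·min(nn_j,nn_k) ≤ 10201/10000·d` apart if bonded to each other and `> 101/100·min(nn_j, nn_k) ≥ d` apart if
  not; the ring number `#(N(i) ∩ N(j)) = 4` is the contact degree inside the dozen.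
* `kr_of_krShape12`, `frustrationDensityGap_of_chargedEnergyGap_of_krShape12`, `aperiodicFrustratedLawGap_of_chargedEnergyGap_of_krShape12` :
  the chain down to the crux BY NAME (`MuEquilibriumDoor ∧ ChargedEnergyGap ∧ KR_shape12`).  `[folklore]`.
-/

noncomputable section

namespace Summit.AtomisticToContinuum.Crystallization.Theorems.FrustratedLawDichotomyKissingRigidityShapeTwelve

open Literature.Geometry.DiscreteGeometry
open Summit.AtomisticToContinuum.Crystallization.Theses.PricedLinkCensus (ChargedEnergyGap)
open Summit.AtomisticToContinuum.Crystallization.Theorems.FrustratedLawDichotomyKissingRigidityShape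
  (kr_of_krShape frustrationDensityGap_of_chargedEnergyGap_of_krShape aperiodicFrustratedLawGap_of_chargedEnergyGap_of_krShape)

/-- **`KR_shape12 → KR_shape`** (module docstring). [folklore] -/
theorem krShape_of_krShape12
    (h12 : ∀ (p : EuclideanSpace ℝ (Fin 3)) (d : ℝ) (q : Fin 12 → EuclideanSpace ℝ (Fin 3)) (E : Fin 12 → Fin 12 → Prop), 0 < d → (∀ a b : Fin 12, E a b → E b a) → (∀ a : Fin 12, ¬ E a a) → (∀ a : Fin 12, d ≤ dist (q a) p ∧ dist (q a) p ≤ 101 / 100 * d) → (∀ a b : Fin 12, a ≠ b → 100 / 101 * d ≤ dist (q a) (q b)) → (∀ a b : Fin 12, E a b → dist (q a) (q b) ≤ 10201 / 10000 * d) → (∀ a b : Fin 12, a ≠ b → ¬ E a b → d < dist (q a) (q b)) → (∀ a : Fin 12, Nat.card {b : Fin 12 // E a b} = 4) → ∃ (η : ℝ) (A : EuclideanSpace ℝ (Fin 3) →ₗᵢ[ℝ] EuclideanSpace ℝ (Fin 3)), η < 1 / 20 ∧ ((∃ e : ↥Literature.Geometry.DiscreteGeometry.fccKissingPattern ≃ Fin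 12, ∀ u : ↥Literature.Geometry.DiscreteGeometry.fccKissingPattern, ‖(q (e u) - p) - d • A (u : EuclideanSpace ℝ (Fin 3))‖ ≤ η * d) ∨ (∃ e : ↥Literature.Geometry.DiscreteGeometry.hcpKissingPattern ≃ Fin 12, ∀ u : ↥Literature.Geometry.DiscreteGeometry.hcpKissingPattern, ‖(q (e u) - p) - d • A (u : EuclideanSpace ℝ (Fin 3))‖ ≤ η * d))) :
    ∀ (N : ℕ) (y : Fin N → EuclideanSpace ℝ (Fin 3)), Function.Injective y → (∀ a b : Fin N, a ≠ b → (7 : ℝ) / 10 ≤ dist (y a) (y b)) → ∀ i : Fin N, Literature.Geometry.DiscreteGeometry.IsChargeFree (1 / 100 : ℝ) y i → ∃ (η : ℝ) (A : EuclideanSpace ℝ (Fin 3) →ₗᵢ[ℝ] EuclideanSpace ℝ (Fin 3)), η < 1 / 20 ∧ ((∃ τ : ↥Literature.Geometry.DiscreteGeometry.fccKissingPattern → Fin N, (∀ u : ↥Literature.Geometry.DiscreteGeometry.fccKissingPattern, (Literature.Geometry.DiscreteGeometry.bondGraph (1 / 100 : ℝ) y).Adj i (τ u)) ∧ (∀ k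 : Fin N, (Literature.Geometry.DiscreteGeometry.bondGraph (1 / 100 : ℝ) y).Adj i k → ∃ u : ↥Literature.Geometry.DiscreteGeometry.fccKissingPattern, τ u = k) ∧ (∀ u : ↥Literature.Geometry.DiscreteGeometry.fccKissingPattern, ‖(y (τ u) - y i) - Literature.Geometry.DiscreteGeometry.nearestDist y i • A (u : EuclideanSpace ℝ (Fin 3))‖ ≤ η * Literature.Geometry.DiscreteGeometry.nearestDist y i)) ∨ (∃ τ : ↥Literature.Geometry.DiscreteGeometry.hcpKissingPattern → Fin N, (∀ u : ↥Literature.Geometry.DiscreteGeometry.hcpKissingPattern, (Literature.Geometry.DiscreteGeometry.bondGraph (1 / 100 : ℝ) y).Adj i (τ u)) ∧ (∀ k : Fin N, (Literature.Geometry.DiscreteGeometry.bondGraph (1 / 100 : ℝ) y).Adj i k → ∃ u : ↥Literature.Geometry.DiscreteGeometry.hcpKissingPattern, τ u = k) ∧ (∀ u : ↥Literature.Geometry.DiscreteGeometry.hcpKissingPattern, ‖(y (τ u) - y i) - Literature.Geometry.DiscreteGeometry.nearestDist y i • A (u : EuclideanSpace ℝ (Fin 3))‖ ≤ η * Literature.Geometry.DiscreteGeometry.nearestDist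 y i))) := by
  classical
  intro N y hy hsep i hcf
  obtain ⟨hcard, hring⟩ := hcf
  set G := bondGraph (1 / 100 : ℝ) y with hG
  set S : Set (Fin N) := G.neighborSet i with hS
  -- enumerate the twelve bonded neighbours
  have hcardS : Nat.card ↥S = 12 := by rw [Nat.card_coe_set_eq]; exact hcard
  set e₀ : Fin 12 ≃ ↥S := (Finite.equivFinOfCardEq hcardS).symm with he₀
  have hmem : ∀ a : Fin 12, G.Adj i (e₀ a : Fin N) := fun a => (e₀ a).2
  have hne : ∀ a : Fin 12, (e₀ a : Fin N) ≠ i := fun a => (G.ne_of_adj (hmem a)).symm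
  -- the scale
  set d := nearestDist y i with hd
  have hd7 : (7 : ℝ) / 10 ≤ d := le_nearestDist ⟨_, hne 0⟩ fun k hk => hsep i k (fun h => hk h.symm)
  have hd0 : 0 < d := by linarith
  -- bond inequalities at `i`
  have hbond : ∀ a : Fin 12, d ≤ dist (y i) (y (e₀ a)) ∧ dist (y i) (y (e₀ a)) ≤ (1 + 1 / 100) * d ∧
      dist (y i) (y (e₀ a)) ≤ (1 + 1 / 100) * nearestDist y (e₀ a) ∧ nearestDist y (e₀ a) ≤ dist (y i) (y (e₀ a)) := by
    intro a
    obtain ⟨-, hle⟩ := bondGraph_adj.1 (hmem a)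
    refine ⟨nearestDist_le_dist y (hne a), hle.trans (mul_le_mul_of_nonneg_left (min_le_left _ _) (by norm_num)),
      hle.trans (mul_le_mul_of_nonneg_left (min_le_right _ _) (by norm_num)), ?_⟩
    rw [dist_comm]; exact nearestDist_le_dist y (hne a).symm
  have hnn : ∀ a : Fin 12, 100 / 101 * d ≤ nearestDist y (e₀ a) ∧ nearestDist y (e₀ a) ≤ 101 / 100 * d := by
    intro a
    obtain ⟨h1, h2, h3, h4⟩ := hbond a
    constructor <;> nlinarith
  -- the twelve-point data
  obtain ⟨η, A, hη, hfit⟩ := h12 (y i) d (fun a => y (e₀ a)) (fun a b => G.Adj (e₀ a) (e₀ b)) hd0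
    (fun a b h => h.symm) (fun a h => G.irrefl h)
    (fun a => by
      obtain ⟨h1, h2, -, -⟩ := hbond a
      rw [dist_comm] at h1 h2
      exact ⟨h1, by linarith⟩)
    (fun a b hab => by
      have hjk : (e₀ a : Fin N) ≠ e₀ b := fun h => hab (e₀.injective (Subtype.ext h))
      have := nearestDist_le_dist y hjk.symm
      linarith [(hnn a).1])
    (fun a b hab => by
      obtain ⟨-, hle⟩ := bondGraph_adj.1 hab
      have := (hnn a).2
      have hmin : min (nearestDist y (e₀ a)) (nearestDist y (e₀ b)) ≤ nearestDist y (e₀ a) := min_le_left _ _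
      nlinarith [hmin, hle])
    (fun a b hab hnadj => by
      have hjk : (e₀ a : Fin N) ≠ e₀ b := fun h => hab (e₀.injective (Subtype.ext h))
      have hlt : ¬ dist (y (e₀ a)) (y (e₀ b)) ≤ (1 + 1 / 100) * min (nearestDist y (e₀ a)) (nearestDist y (e₀ b)) :=
        fun h => hnadj (bondGraph_adj.2 ⟨hjk, h⟩)
      have hmin : 100 / 101 * d ≤ min (nearestDist y (e₀ a)) (nearestDist y (e₀ b)) := le_min (hnn a).1 (hnn b).1
      push Not at hlt
      nlinarith)
    (fun a => by
      -- contact degree inside the dozen = ring number `#(N(i) ∩ N(j)) = 4`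
      have hr := hring (e₀ a) (e₀ a).2
      rw [ringNumber_def] at hr
      rw [← hr, ← Nat.card_coe_set_eq]
      refine Nat.card_congr ?_
      exact
        { toFun := fun b => ⟨(e₀ b.1 : Fin N), (e₀ b.1).2, (SimpleGraph.mem_neighborSet _ _ _).2 b.2⟩
          invFun := fun k => ⟨e₀.symm ⟨k.1, k.2.1⟩, by
            have hk : G.Adj (e₀ a) k.1 := (SimpleGraph.mem_neighborSet _ _ _).1 k.2.2
            simpa only [Equiv.apply_symm_apply] using hk⟩
          left_inv := fun b => by ext; simp
          right_inv := fun k => by ext; simp })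
  refine ⟨η, A, hη, ?_⟩
  rcases hfit with ⟨e, he⟩ | ⟨e, he⟩
  · refine Or.inl ⟨fun u => (e₀ (e u) : Fin N), fun u => hmem (e u), fun k hk => ?_, fun u => he u⟩
    refine ⟨e.symm (e₀.symm ⟨k, (SimpleGraph.mem_neighborSet _ _ _).2 hk⟩), ?_⟩
    simp only [Equiv.apply_symm_apply]
  · refine Or.inr ⟨fun u => (e₀ (e u) : Fin N), fun u => hmem (e u), fun k hk => ?_, fun u => he u⟩
    refine ⟨e.symm (e₀.symm ⟨k, (SimpleGraph.mem_neighborSet _ _ _).2 hk⟩), ?_⟩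
    simp only [Equiv.apply_symm_apply]

/-- **`KR_shape12 → KR`.** [folklore] -/
theorem kr_of_krShape12
    (h12 : ∀ (p : EuclideanSpace ℝ (Fin 3)) (d : ℝ) (q : Fin 12 → EuclideanSpace ℝ (Fin 3)) (E : Fin 12 → Fin 12 → Prop), 0 < d → (∀ a b : Fin 12, E a b → E b a) → (∀ a : Fin 12, ¬ E a a) → (∀ a : Fin 12, d ≤ dist (q a) p ∧ dist (q a) p ≤ 101 / 100 * d) → (∀ a b : Fin 12, a ≠ b → 100 / 101 * d ≤ dist (q a) (q b)) → (∀ a b : Fin 12, E a b → dist (q a) (q b) ≤ 10201 / 10000 * d) → (∀ a b : Fin 12, a ≠ b → ¬ E a b → d < dist (q a) (q b)) → (∀ a : Fin 12, Nat.card {b : Fin 12 // E a b} = 4) → ∃ (η : ℝ) (A : EuclideanSpace ℝ (Fin 3) →ₗᵢ[ℝ] EuclideanSpace ℝ (Fin 3)), η < 1 / 20 ∧ ((∃ e : ↥Literature.Geometry.DiscreteGeometry.fccKissingPattern ≃ Fin 12, ∀ u : ↥Literature.Geometry.DiscreteGeometry.fccKissingPattern, ‖(q (e u) - p) - d • A (u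 : EuclideanSpace ℝ (Fin 3))‖ ≤ η * d) ∨ (∃ e : ↥Literature.Geometry.DiscreteGeometry.hcpKissingPattern ≃ Fin 12, ∀ u : ↥Literature.Geometry.DiscreteGeometry.hcpKissingPattern, ‖(q (e u) - p) - d • A (u : EuclideanSpace ℝ (Fin 3))‖ ≤ η * d))) :
    ∀ (N : ℕ) (y : Fin N → EuclideanSpace ℝ (Fin 3)), Function.Injective y → (∀ a b : Fin N, a ≠ b → (7 : ℝ) / 10 ≤ dist (y a) (y b)) → ∀ i : Fin N, Literature.Geometry.DiscreteGeometry.IsChargeFree (1 / 100 : ℝ) y i → ∃ (d η γ : ℝ) (A : EuclideanSpace ℝ (Fin 3) →ₗᵢ[ℝ] EuclideanSpace ℝ (Fin 3)), (∃ t : ↥Literature.Geometry.DiscreteGeometry.fccKissingPattern → EuclideanSpace ℝ (Fin 3), 0 < d ∧ 0 < γ ∧ η < 1 / 20 ∧ (∀ u : ↥Literature.Geometry.DiscreteGeometry.fccKissingPattern, t u ∈ (Set.range y) ∧ ‖(t u - (y i)) - d • A (u : EuclideanSpace ℝ (Fin 3))‖ ≤ η * d) ∧ (∀ s : EuclideanSpace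 ℝ (Fin 3), s ∈ (Set.range y) → s ≠ (y i) → d ≤ dist s (y i)) ∧ (∃ s : EuclideanSpace ℝ (Fin 3), s ∈ (Set.range y) ∧ s ≠ (y i) ∧ dist s (y i) ≤ d) ∧ (∀ s : EuclideanSpace ℝ (Fin 3), s ∈ (Set.range y) → s ≠ (y i) → dist s (y i) < 13 / 10 * d + γ → dist s (y i) ≤ 13 / 10 * d - γ ∧ s ∈ Set.range t)) ∨ (∃ t : ↥Literature.Geometry.DiscreteGeometry.hcpKissingPattern → EuclideanSpace ℝ (Fin 3), 0 < d ∧ 0 < γ ∧ η < 1 / 20 ∧ (∀ u : ↥Literature.Geometry.DiscreteGeometry.hcpKissingPattern, t u ∈ (Set.range y) ∧ ‖(t u - (y i)) - d • A (u : EuclideanSpace ℝ (Fin 3))‖ ≤ η * d) ∧ (∀ s : EuclideanSpace ℝ (Fin 3), s ∈ (Set.range y) → s ≠ (y i) → d ≤ dist s (y i)) ∧ (∃ s : EuclideanSpace ℝ (Fin 3), s ∈ (Set.range y) ∧ s ≠ (y i) ∧ dist s (y i) ≤ d) ∧ (∀ s : EuclideanSpace ℝ (Fin 3), s ∈ (Set.range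 y) → s ≠ (y i) → dist s (y i) < 13 / 10 * d + γ → dist s (y i) ≤ 13 / 10 * d - γ ∧ s ∈ Set.range t)) := kr_of_krShape (krShape_of_krShape12 h12)

/-- **`ChargedEnergyGap ∧ KR_shape12 ⟹ FDG`.** [folklore] -/
theorem frustrationDensityGap_of_chargedEnergyGap_of_krShape12 (hgap : ChargedEnergyGap)
    (h12 : ∀ (p : EuclideanSpace ℝ (Fin 3)) (d : ℝ) (q : Fin 12 → EuclideanSpace ℝ (Fin 3)) (E : Fin 12 → Fin 12 → Prop), 0 < d → (∀ a b : Fin 12, E a b → E b a) → (∀ a : Fin 12, ¬ E a a) → (∀ a : Fin 12, d ≤ dist (q a) p ∧ dist (q a) p ≤ 101 / 100 * d) → (∀ a b : Fin 12, a ≠ b → 100 / 101 * d ≤ dist (q a) (q b)) → (∀ a b : Fin 12, E a b → dist (q a) (q b) ≤ 10201 / 10000 * d) → (∀ a b : Fin 12, a ≠ b → ¬ E a b → d < dist (q a) (q b)) → (∀ a : Fin 12, Nat.card {b : Fin 12 // E a b} = 4) → ∃ (η : ℝ) (A : EuclideanSpace ℝ (Fin 3) →ₗᵢ[ℝ] EuclideanSpace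 ℝ (Fin 3)), η < 1 / 20 ∧ ((∃ e : ↥Literature.Geometry.DiscreteGeometry.fccKissingPattern ≃ Fin 12, ∀ u : ↥Literature.Geometry.DiscreteGeometry.fccKissingPattern, ‖(q (e u) - p) - d • A (u : EuclideanSpace ℝ (Fin 3))‖ ≤ η * d) ∨ (∃ e : ↥Literature.Geometry.DiscreteGeometry.hcpKissingPattern ≃ Fin 12, ∀ u : ↥Literature.Geometry.DiscreteGeometry.hcpKissingPattern, ‖(q (e u) - p) - d • A (u : EuclideanSpace ℝ (Fin 3))‖ ≤ η * d))) :
    ∃ κ : ℝ, 0 < κ ∧ ∃ C : ℝ, ∀ (N : ℕ) (y : Fin N → EuclideanSpace ℝ (Fin 3)), Function.Injective y → (∀ a b : Fin N, a ≠ b → (7 : ℝ) / 10 ≤ dist (y a) (y b)) → κ * N - C * (Nat.card {i : Fin N // ∃ (d η γ : ℝ) (A : EuclideanSpace ℝ (Fin 3) →ₗᵢ[ℝ] EuclideanSpace ℝ (Fin 3)), (∃ t : ↥Literature.Geometry.DiscreteGeometry.fccKissingPattern → EuclideanSpace ℝ (Fin 3), 0 < d ∧ 0 < γ ∧ η < 1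 / 20 ∧ (∀ u : ↥Literature.Geometry.DiscreteGeometry.fccKissingPattern, t u ∈ (Set.range y) ∧ ‖(t u - (y i)) - d • A (u : EuclideanSpace ℝ (Fin 3))‖ ≤ η * d) ∧ (∀ s : EuclideanSpace ℝ (Fin 3), s ∈ (Set.range y) → s ≠ (y i) → d ≤ dist s (y i)) ∧ (∃ s : EuclideanSpace ℝ (Fin 3), s ∈ (Set.range y) ∧ s ≠ (y i) ∧ dist s (y i) ≤ d) ∧ (∀ s : EuclideanSpace ℝ (Fin 3), s ∈ (Set.range y) → s ≠ (y i) → dist s (y i) < 13 / 10 * d + γ → dist s (y i) ≤ 13 / 10 * d - γ ∧ s ∈ Set.range t)) ∨ (∃ t : ↥Literature.Geometry.DiscreteGeometry.hcpKissingPattern → EuclideanSpace ℝ (Fin 3), 0 < d ∧ 0 < γ ∧ η < 1 / 20 ∧ (∀ u : ↥Literature.Geometry.DiscreteGeometry.hcpKissingPattern, t u ∈ (Set.range y) ∧ ‖(t u - (y i)) - d • A (u : EuclideanSpace ℝ (Fin 3))‖ ≤ η * d) ∧ (∀ s : EuclideanSpace ℝ (Fin 3), s ∈ (Set.range y) → s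 ≠ (y i) → d ≤ dist s (y i)) ∧ (∃ s : EuclideanSpace ℝ (Fin 3), s ∈ (Set.range y) ∧ s ≠ (y i) ∧ dist s (y i) ≤ d) ∧ (∀ s : EuclideanSpace ℝ (Fin 3), s ∈ (Set.range y) → s ≠ (y i) → dist s (y i) < 13 / 10 * d + γ → dist s (y i) ≤ 13 / 10 * d - γ ∧ s ∈ Set.range t))} : ℝ) ≤ Literature.MathematicalPhysics.StatisticalMechanics.interactionEnergy Literature.MathematicalPhysics.StatisticalMechanics.lennardJones y - N * (⨅ Q : Literature.MathematicalPhysics.StatisticalMechanics.PeriodicConfiguration 3, Q.energyPerParticle Literature.MathematicalPhysics.StatisticalMechanics.lennardJones) :=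
  frustrationDensityGap_of_chargedEnergyGap_of_krShape hgap (krShape_of_krShape12 h12)

/-- **`AperiodicFrustratedLawGap` (crux of item 27623) BY NAME from `MuEquilibriumDoor ∧ ChargedEnergyGap ∧ KR_shape12`.** [folklore] -/
theorem aperiodicFrustratedLawGap_of_chargedEnergyGap_of_krShape12
    (hDoor : Summit.AtomisticToContinuum.Crystallization.Theses.GrainCoreNetworkSplit.MuEquilibriumDoor) (hgap : ChargedEnergyGap)
    (h12 : ∀ (p : EuclideanSpace ℝ (Fin 3)) (d : ℝ) (q : Fin 12 → EuclideanSpace ℝ (Fin 3)) (E : Fin 12 → Fin 12 → Prop), 0 < d → (∀ a b : Fin 12, E a b → E b a) → (∀ a : Fin 12, ¬ E a a) → (∀ a : Fin 12, d ≤ dist (q a) p ∧ dist (q a) p ≤ 101 / 100 * d) → (∀ a b : Fin 12, a ≠ b → 100 / 101 * d ≤ dist (q a) (q b)) → (∀ a b : Fin 12, E a b → dist (q a) (q b) ≤ 10201 / 10000 * d) → (∀ a b : Fin 12, a ≠ b → ¬ E a b → d < dist (q a) (q b)) → (∀ a : Fin 12, Nat.card {b : Fin 12 // E a b} = 4) →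 ∃ (η : ℝ) (A : EuclideanSpace ℝ (Fin 3) →ₗᵢ[ℝ] EuclideanSpace ℝ (Fin 3)), η < 1 / 20 ∧ ((∃ e : ↥Literature.Geometry.DiscreteGeometry.fccKissingPattern ≃ Fin 12, ∀ u : ↥Literature.Geometry.DiscreteGeometry.fccKissingPattern, ‖(q (e u) - p) - d • A (u : EuclideanSpace ℝ (Fin 3))‖ ≤ η * d) ∨ (∃ e : ↥Literature.Geometry.DiscreteGeometry.hcpKissingPattern ≃ Fin 12, ∀ u : ↥Literature.Geometry.DiscreteGeometry.hcpKissingPattern, ‖(q (e u) - p) - d • A (u : EuclideanSpace ℝ (Fin 3))‖ ≤ η * d))) :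
    Summit.AtomisticToContinuum.Crystallization.Theses.FrustratedLawDichotomy.AperiodicFrustratedLawGap :=
  aperiodicFrustratedLawGap_of_chargedEnergyGap_of_krShape hDoor hgap (krShape_of_krShape12 h12)

end Summit.AtomisticToContinuum.Crystallization.Theorems.FrustratedLawDichotomyKissingRigidityShapeTwelve

end
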